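import Summits.NavierStokesRegularity.NavierStokesRegularity.Theorems.UnthreadedDoorIndicatrixAnalyticDataComposition
import Summits.NavierStokesRegularity.NavierStokesRegularity.Theorems.UnthreadedDoorIndicatrixAnalyticFrameOfAnalyticData
import Summits.NavierStokesRegularity.NavierStokesRegularity.Theorems.UnthreadedDoorNetFluxTypeIDichotomyByName
import Summits.NavierStokesRegularity.NavierStokesRegularity.Theorems.UnthreadedDoorNetFluxPoloidalLiouvilleTypeIOfMultiHill
import HarnessLib

/-!
# Route `UnthreadedDoor`, crux `PoloidalLiouville` (stmt-NavierStokesRegularity-1222), WALL W1 — the indicatrix / cell-flux programme's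
# END STATE BY NAME: the Type-I half of W1 modulo five named items

Bookkeeping file (theorems only, no new statements; `--supports stmt-NavierStokesRegularity-1222 --as helper`).  It composes two landed chains:
* ns-qj-p1 g8's `Indicatrix.analyticDataTypeIScalarLiouville_of` (p730353): «`ℝ_an,exp` is o-minimal» (`hO`) + Λ-1 `HeadClusterRuleTame` + Λ-2
  `ClusterFluxOneSidedLawTame` + Λ-0b+c `IndicatrixLeHessian` + Σ-0bR₂ `ClusterFluxNearCentreLipschitz` ⟹ K3^ω `AnalyticDataTypeIScalarLiouville`;
* ARM A g8's `Indicatrix.typeIScalarLiouville_of_analyticData` (p730290): K3^ω ⟹ `CellFlux.TypeIScalarLiouville` (radial gauge Λ-5 + gauge rigidity Σ-5a + zonal branch);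
and the landed Type-I bookkeeping of the netflux line (`CellFlux.persistentSheet_of_typeI` p693177, `NetFlux.multiHillScalarLiouvilleTypeI_of_persistentSheetResidual`
p689880, `NetFlux.poloidalLiouvilleTypeI_of_multiHill`):
★ `typeIScalarLiouville_of_indicatrixResidue` — `TypeIScalarLiouville` modulo {hO, Λ-1, Λ-2, Λ-0b+c, Σ-0bR₂};
★★ `poloidalLiouvilleTypeI_of_indicatrixResidue` — C⁻ «every Type-I unthreaded bounded ancient mild solution, smooth on the slab, has constant time slices»
modulo the same five named items.  HONEST LABEL: a REDUCTION that names the residue; none of the five is claimed (Λ-1/Λ-2 = the head-cluster rule and its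
one-sided law, Λ-0b+c = the Polterovich–Sodin bridge, Σ-0bR₂ = near-centre Lipschitz control of the cluster flux, hO = o-minimality of `ℝ_an,exp`);
C⁻ is the Type-I sub-statement, NOT the W1 decl `PoloidalLiouville`; ⟨1222⟩, W1 and NS regularity stay OPEN.  ARM A `pub/ns-exp-scalarLiouville` g8.
-/

noncomputable section

-- the summit and its single sub-problem share the name (CONVENTIONS §1)
set_option linter.dupNamespace false

open Set Function Filter Topology InnerProductSpace MeasureTheory Metric
open scoped RealInnerProductSpace

namespace Summit.NavierStokesRegularity.NavierStokesRegularity.Theorems.PoloidalLiouville.Indicatrix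

open Summit.NavierStokesRegularity.NavierStokesRegularity.Theorems.PoloidalLiouville.NetFlux
  (E3 CurledLaw poloidalLiouvilleTypeI_of_multiHill multiHillScalarLiouvilleTypeI_of_persistentSheetResidual)
open Summit.NavierStokesRegularity.NavierStokesRegularity.Theorems.PoloidalLiouville.CellFlux
  (cellFinitePred AdmissibleRule OneSidedLawFor clusterFlux ClusterFluxNearCentreLipschitz TypeIScalarLiouville persistentSheet_of_typeI)
open Literature.Analysis Literature.Analysis.FluidPDE

/-- ★ **The Type-I half of W1 modulo five named items**: o-minimality of `ℝ_an,exp`, Λ-1, Λ-2, Λ-0b+c (bodies verbatim, as in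
`analyticDataTypeIScalarLiouville_of`) and Σ-0bR₂ imply `CellFlux.TypeIScalarLiouville`. [folklore] -/
theorem typeIScalarLiouville_of_indicatrixResidue
    (hO : Literature.ModelTheory.ExponentialFields.VandendriesMiller1994_realAnExp_isOMinimal)
    (h1 : ∀ (v : ℝ → E3 → E3) (x₀ : E3) (T P : ℝ → E3 → ℝ) (V : ℝ → ℝ) (t₀ : ℝ),
      ContDiffOn ℝ (⊤ : ℕ∞) (uncurry v) (Ioo t₀ 0 ×ˢ univ) →
      ContDiffOn ℝ (⊤ : ℕ∞) (uncurry T) (Ioo t₀ 0 ×ˢ ({x₀}ᶜ : Set E3)) →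
      (∀ t ∈ Ioo t₀ 0, ContDiffOn ℝ 1 (P t) ({x₀}ᶜ : Set E3)) →
      (∀ t ∈ Ioo t₀ 0, ∀ x, ‖v t x‖ ≤ V t) →
      (∀ t ∈ Ioo t₀ 0, ∀ x, x ≠ x₀ →
          cross (gradient (P t) x - (inner ℝ (v t x) (x - x₀)) • gradient (T t) x) (x - x₀) = 0) →
      (∀ t ∈ Ioo t₀ 0, ∀ x, curl (v t) x = cross (gradient (T t) x) (x - x₀)) →
      CurledLaw v x₀ T (Ioo t₀ 0) →
      AnalyticOnNhd ℝ (uncurry v) (Ioo t₀ 0 ×ˢ (univ : Set E3)) →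
      AnalyticOnNhd ℝ (uncurry T) (Ioo t₀ 0 ×ˢ ({x₀}ᶜ : Set E3)) →
      (∀ t ∈ Ioo t₀ 0, cellFinitePred v x₀ T t) →
      ∃ 𝒞 : ℝ → ℝ → Set (Set E3), AdmissibleRule x₀ T P V t₀ 𝒞 ∧
        ∀ t ∈ Ioo t₀ 0, ∀ r > 0, ∀ K ∈ 𝒞 t r, IsPreconnected (T t '' K))
    (h2 : ∀ (v : ℝ → E3 → E3) (x₀ : E3) (T P : ℝ → E3 → ℝ) (V : ℝ → ℝ) (t₀ : ℝ),
      ContDiffOn ℝ (⊤ : ℕ∞) (uncurry v) (Ioo t₀ 0 ×ˢ univ) →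
      ContDiffOn ℝ (⊤ : ℕ∞) (uncurry T) (Ioo t₀ 0 ×ˢ ({x₀}ᶜ : Set E3)) →
      (∀ t ∈ Ioo t₀ 0, ContDiffOn ℝ 1 (P t) ({x₀}ᶜ : Set E3)) →
      (∀ t ∈ Ioo t₀ 0, ∀ x, ‖v t x‖ ≤ V t) →
      (∀ t ∈ Ioo t₀ 0, ∀ x, x ≠ x₀ →
          cross (gradient (P t) x - (inner ℝ (v t x) (x - x₀)) • gradient (T t) x) (x - x₀) = 0) →
      (∀ t ∈ Ioo t₀ 0, ∀ x, curl (v t) x = cross (gradient (T t) x) (x - x₀)) →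
      CurledLaw v x₀ T (Ioo t₀ 0) →
      (∀ t ∈ Ioo t₀ 0, cellFinitePred v x₀ T t) →
      ∀ 𝒞 : ℝ → ℝ → Set (Set E3), AdmissibleRule x₀ T P V t₀ 𝒞 →
        OneSidedLawFor (fun t r => clusterFlux (T t) r (𝒞 t r)) V t₀ (fun _ => True))
    (hb : ∃ C : ℝ, 0 ≤ C ∧ ∀ (u : E3 → E3) (x₀ : E3) (f : E3 → ℝ) (r K : ℝ), 0 < r →
      ContDiff ℝ 2 u → AnalyticOnNhd ℝ f ({x₀}ᶜ : Set E3) →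
      (∀ x, curl u x = cross (gradient f x) (x - x₀)) →
      (∀ x ∈ Metric.sphere x₀ r, ‖iteratedFDeriv ℝ 2 u x‖ ≤ K) →
      Literature.Analysis.PDE.banachIndicatrix (Metric.sphere x₀ r) f ≤ ENNReal.ofReal (C * r * K))
    (hR₂ : ClusterFluxNearCentreLipschitz) :
    TypeIScalarLiouville :=
  typeIScalarLiouville_of_analyticData (analyticDataTypeIScalarLiouville_of hO h1 h2 hb hR₂)

/-- ★★ **C⁻, the Type-I poloidal Liouville, modulo the same five named items**: every Type-I unthreaded (`⟪x − x₀, ω⟫ ≡ 0` about one centre)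
bounded ancient mild solution, smooth on the slab, has constant time slices (the body of `NetFlux.poloidalLiouvilleTypeI_of_multiHill`'s conclusion). [folklore] -/
theorem poloidalLiouvilleTypeI_of_indicatrixResidue
    (hO : Literature.ModelTheory.ExponentialFields.VandendriesMiller1994_realAnExp_isOMinimal)
    (h1 : ∀ (v : ℝ → E3 → E3) (x₀ : E3) (T P : ℝ → E3 → ℝ) (V : ℝ → ℝ) (t₀ : ℝ),
      ContDiffOn ℝ (⊤ : ℕ∞) (uncurry v) (Ioo t₀ 0 ×ˢ univ) →
      ContDiffOn ℝ (⊤ : ℕ∞) (uncurry T) (Ioo t₀ 0 ×ˢ ({x₀}ᶜ : Set E3)) →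
      (∀ t ∈ Ioo t₀ 0, ContDiffOn ℝ 1 (P t) ({x₀}ᶜ : Set E3)) →
      (∀ t ∈ Ioo t₀ 0, ∀ x, ‖v t x‖ ≤ V t) →
      (∀ t ∈ Ioo t₀ 0, ∀ x, x ≠ x₀ →
          cross (gradient (P t) x - (inner ℝ (v t x) (x - x₀)) • gradient (T t) x) (x - x₀) = 0) →
      (∀ t ∈ Ioo t₀ 0, ∀ x, curl (v t) x = cross (gradient (T t) x) (x - x₀)) →
      CurledLaw v x₀ T (Ioo t₀ 0) →
      AnalyticOnNhd ℝ (uncurry v) (Ioo t₀ 0 ×ˢ (univ : Set E3)) →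
      AnalyticOnNhd ℝ (uncurry T) (Ioo t₀ 0 ×ˢ ({x₀}ᶜ : Set E3)) →
      (∀ t ∈ Ioo t₀ 0, cellFinitePred v x₀ T t) →
      ∃ 𝒞 : ℝ → ℝ → Set (Set E3), AdmissibleRule x₀ T P V t₀ 𝒞 ∧
        ∀ t ∈ Ioo t₀ 0, ∀ r > 0, ∀ K ∈ 𝒞 t r, IsPreconnected (T t '' K))
    (h2 : ∀ (v : ℝ → E3 → E3) (x₀ : E3) (T P : ℝ → E3 → ℝ) (V : ℝ → ℝ) (t₀ : ℝ),
      ContDiffOn ℝ (⊤ : ℕ∞) (uncurry v) (Ioo t₀ 0 ×ˢ univ) →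
      ContDiffOn ℝ (⊤ : ℕ∞) (uncurry T) (Ioo t₀ 0 ×ˢ ({x₀}ᶜ : Set E3)) →
      (∀ t ∈ Ioo t₀ 0, ContDiffOn ℝ 1 (P t) ({x₀}ᶜ : Set E3)) →
      (∀ t ∈ Ioo t₀ 0, ∀ x, ‖v t x‖ ≤ V t) →
      (∀ t ∈ Ioo t₀ 0, ∀ x, x ≠ x₀ →
          cross (gradient (P t) x - (inner ℝ (v t x) (x - x₀)) • gradient (T t) x) (x - x₀) = 0) →
      (∀ t ∈ Ioo t₀ 0, ∀ x, curl (v t) x = cross (gradient (T t) x) (x - x₀)) →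
      CurledLaw v x₀ T (Ioo t₀ 0) →
      (∀ t ∈ Ioo t₀ 0, cellFinitePred v x₀ T t) →
      ∀ 𝒞 : ℝ → ℝ → Set (Set E3), AdmissibleRule x₀ T P V t₀ 𝒞 →
        OneSidedLawFor (fun t r => clusterFlux (T t) r (𝒞 t r)) V t₀ (fun _ => True))
    (hb : ∃ C : ℝ, 0 ≤ C ∧ ∀ (u : E3 → E3) (x₀ : E3) (f : E3 → ℝ) (r K : ℝ), 0 < r →
      ContDiff ℝ 2 u → AnalyticOnNhd ℝ f ({x₀}ᶜ : Set E3) →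
      (∀ x, curl u x = cross (gradient f x) (x - x₀)) →
      (∀ x ∈ Metric.sphere x₀ r, ‖iteratedFDeriv ℝ 2 u x‖ ≤ K) →
      Literature.Analysis.PDE.banachIndicatrix (Metric.sphere x₀ r) f ≤ ENNReal.ofReal (C * r * K))
    (hR₂ : ClusterFluxNearCentreLipschitz) :
    ∀ v : ℝ → E3 → E3,
      ((∃ C : ℝ, HasTypeITimeDecay C v) ∧ IsBoundedAncientMildSolution 1 v ∧
        (∀ t < 0, AEStronglyMeasurable (v t) volume) ∧
        ContDiffOn ℝ (⊤ : ℕ∞) (Function.uncurry v) (Set.Iio 0 ×ˢ Set.univ) ∧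
        ∃ x₀ : E3, ∀ t < 0, ∀ x, inner ℝ (x - x₀) (curl (v t) x) = 0) →
      ∀ t < 0, ∃ b : E3, ∀ x, v t x = b :=
  poloidalLiouvilleTypeI_of_multiHill
    (multiHillScalarLiouvilleTypeI_of_persistentSheetResidual
      (persistentSheet_of_typeI (typeIScalarLiouville_of_indicatrixResidue hO h1 h2 hb hR₂)))

end Summit.NavierStokesRegularity.NavierStokesRegularity.Theorems.PoloidalLiouville.Indicatrix

end
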